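import Summits.AnomalousDissipation.AnomalousDissipation.Theorems.SawtoothPulseCascadeK1LocalisedCascadeTwoToothOffLobe
import Summits.AnomalousDissipation.AnomalousDissipation.Theorems.SawtoothPulseCascadeK1LocalisedCascadePhaseOneHSum

/-!
# K1loc explicit start, phase 1: the energy of `b₁` OFF THE TUBE `||k₁| − 8|k₀|| < D₀` («PhaseOneOffTube», dischargers j_V / j_O)

Helper file of the prover lane on the crux `K1LocalisedCascade` (stmt-AnomalousDissipation-19491), route `SawtoothPulseCascade`
(arbiter A24-5 R1).  `b₁ = a₁ ∘ H(ψ₁)` carries its energy near the lobes `k₁ ≈ ±8k₀` of the two-tooth chirps; the energy off the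
tube `T(D₀) = {k : ||k₁| − 8|k₀|| < D₀}` is the «far» term of the tube Cauchy–Schwarz bound `K1Window.vfibre_window_sq_le`.
* §1 **`phaseOne_offTube_fibre_le`**: on one H-fibre `k₀ = q`, for every finite window `W` off the tube,
  `Σ_{l∈W} ‖𝓕b₁(q,l)‖² ≤ (L̄_q·ρ_q + √R_q)²`, `ρ_q = √(6/(π²(E−1))) + 2⁻²⁷|q|` (`2E + Q_c ≤ D₀`), `L̄_q ≥ Σ_{1≤|q'|≤Q_c}‖𝓕a₁(q,q')‖`
  (tables `PhaseOneL1Tables*`), `R_q` the fibre's `ℓ²` remainder (fibre Minkowski `sqrt_window_sq_norm_hstep_le`, off-lobe window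
  masses `sum_offLobe_window_sq_norm_twist_le`, rounding `phaseOne_profile_near`);
* §2 **`phaseOne_offTube_le_of_fibres`**: the lattice sum `Σ'_k [k ∉ T(D₀)] ‖𝓕b₁(k)‖²` is at most the sum of per-fibre bounds over
  `|q| ≤ P_c` plus the H-tail of `a₁` beyond `P_c` (fibrewise summation, H-invariance of H-fibre energies).
No definitions; nothing about the crux. [cite: Grafakos2014, Prop. 3.1.2 (5), Prop. 3.2.7 (3)] [problem: turb]
-/

-- `Summit.<Summit>.<Problem>`: single-conjunct summit, the duplicate namespace segment is deliberate.
set_option linter.dupNamespace false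

noncomputable section

namespace Summit.AnomalousDissipation.AnomalousDissipation.Theorems.SawtoothPulseCascade.K1Start

open MeasureTheory Filter Topology UnitAddTorus Complex AddCircle
open scoped Real
open Literature.Analysis Literature.Analysis.FunctionSpaces Literature.Analysis.FunctionSpaces.Torus Literature.Analysis.FluidPDE
open Literature.Analysis.FluidPDE.ShearStage
open Literature.Analysis.FluidPDE.SawtoothCascade Literature.Analysis.FluidPDE.SawtoothCascade.CascadeParams
open Summit.AnomalousDissipation.AnomalousDissipation.Theorems.SawtoothPulseCascade.K1Window

section Cascade

variable (P : CascadeParams)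

/-! ## §1 One H-fibre off the tube -/

/-- **ONE H-FIBRE OF `b₁` OFF THE TUBE**: for `q : ℤ`, `2 ≤ E`, `2E + Q_c ≤ D₀`, a bound `L̄` on `Σ_{1≤|q'|≤Q_c}‖𝓕a₁(q,q')‖`, and a finite
window `W` with `D₀ ≤ ||l| − |8q||` on `W`:
`Σ_{l∈W} ‖𝓕b₁(q,l)‖² ≤ (L̄·(√(6/(π²(E−1))) + 2⁻²⁷|q|) + √R_q)²`, `R_q = Σ'_{q' : ¬(1≤|q'|≤Q_c)} ‖𝓕a₁(q,q')‖²`.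
[cite: Grafakos2014, Prop. 3.1.2 (5), Prop. 3.2.7 (3)] -/
theorem phaseOne_offTube_fibre_le (hγ : P.γ = 8) (hN₀ : P.N₀ = 1) (hρN : P.ρN = 2) (hd : P.d = 2) (hδ₀ : 0 < P.δ₀)
    (hδ₀' : P.δ₀ ≤ (2 : ℝ)⁻¹ ^ 30) (a b : ℕ → UnitAddTorus (Fin 2) → ℝ) (h0 : a 0 = datum)
    (hb : ∀ j, b j = a j ∘ shearMap 0 1 (amp ⟨P.U j, P.U_periodic j, P.contDiff_U (P.δ_pos hδ₀ (by rw [hd]; norm_num) j)⟩ P.γ))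
    (hab : ∀ j, a (j + 1) = b j ∘ shearMap 1 0 (amp ⟨P.U j, P.U_periodic j, P.contDiff_U (P.δ_pos hδ₀ (by rw [hd]; norm_num) j)⟩ P.γ))
    (q : ℤ) (Qc D₀ E : ℕ) (hE : 2 ≤ E) (hD : 2 * (E : ℤ) + Qc ≤ D₀) {L : ℝ}
    (hL : ∑ q' ∈ (Finset.Icc (-(Qc : ℤ)) Qc).filter (fun q' => 1 ≤ |q'|), ‖mFourierCoeff (fun x => (a 1 x : ℂ)) ![q, q']‖ ≤ L)
    (W : Finset ℤ) (hW : ∀ l ∈ W, (D₀ : ℤ) ≤ |(|l| - |8 * q|)|) :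
    ∑ l ∈ W, ‖mFourierCoeff (fun x => (b 1 x : ℂ)) ![q, l]‖ ^ 2 ≤
      (L * (Real.sqrt (6 / (π ^ 2 * ((E : ℝ) - 1))) + (2 : ℝ)⁻¹ ^ 27 * |(q : ℝ)|) +
        Real.sqrt (∑' q' : ℤ, (if q' ∈ (Finset.Icc (-(Qc : ℤ)) Qc).filter (fun q' => 1 ≤ |q'|) then 0
          else ‖mFourierCoeff (fun x => (a 1 x : ℂ)) ![q, q']‖ ^ 2))) ^ 2 := by
  classical
  have hπ : 0 < π := Real.pi_pos
  have hd0 : 0 < P.d := by rw [hd]; norm_num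
  -- the iterates
  set ψ₀ : ShearProfile := amp ⟨P.U 0, P.U_periodic 0, P.contDiff_U (P.δ_pos hδ₀ hd0 0)⟩ P.γ with hψ₀
  set ψ₁ : ShearProfile := amp ⟨P.U 1, P.U_periodic 1, P.contDiff_U (P.δ_pos hδ₀ hd0 1)⟩ P.γ with hψ₁
  have hb0 : b 0 = datum ∘ shearMap 0 1 ψ₀ := by rw [hb 0, h0]
  have ha1 : a 1 = b 0 ∘ shearMap 1 0 ψ₀ := hab 0
  have ha1s : IsSmooth (a 1) := by
    rw [ha1, hb0]; exact (isSmooth_datum_comp_shearMap ψ₀).comp_shearMap 1 0 ψ₀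
  have ha1c : Continuous fun x => (a 1 x : ℂ) := Complex.continuous_ofReal.comp ha1s.continuous
  have ha1sum : Summable fun k => ‖mFourierCoeff (fun x => (a 1 x : ℂ)) k‖ :=
    summable_norm_mFourierCoeff_ofReal_of_isSmooth ha1s
  have hb1 : (fun x => (b 1 x : ℂ)) = (fun x => (a 1 x : ℂ)) ∘ shearMap 0 1 ψ₁ := by
    rw [hb 1]; rfl
  set S : Finset ℤ := (Finset.Icc (-(Qc : ℤ)) Qc).filter (fun q' => 1 ≤ |q'|) with hS
  -- fibre Minkowski over the sources `S`
  have hmink := sqrt_window_sq_norm_hstep_le ha1c ha1sum ψ₁ q S W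
  rw [← hb1] at hmink
  -- the exact two-tooth chirp of fibre `q` and the rounding
  set g₀ : UnitAddCircle → ℂ := (periodic_exactChirpFun 2 (8 * q)).lift with hg₀
  have hg₀c : Continuous g₀ := (continuous_exactChirp_lift 2 (8 * q)).1
  have hg₀t : ∀ t : ℝ, g₀ (t : UnitAddCircle) =
      Complex.exp (-(2 * π * I * ((8 * q : ℤ)) * ((tri (2 * π * (2 : ℕ) * t) / (2 * π * (2 : ℕ)) : ℝ) : ℂ))) :=
    fun t => (continuous_exactChirp_lift 2 (8 * q)).2 t
  have hnear : ∀ t : ℝ, |q * ψ₁ t - ((8 * q : ℤ) : ℝ) * (tri (2 * π * (2 : ℕ) * t) / (2 * π * (2 : ℕ)))| ≤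
      |(q : ℝ)| * ((2 * Real.exp (1 / 2) - 1) * P.δ₀ / π) := fun t => by
    rw [hψ₁]; exact phaseOne_profile_near P hγ hN₀ hρN hd hδ₀ q t
  have hround : 2 * π * (|(q : ℝ)| * ((2 * Real.exp (1 / 2) - 1) * P.δ₀ / π)) ≤ (2 : ℝ)⁻¹ ^ 27 * |(q : ℝ)| :=
    phaseOne_rounding_le hδ₀.le hδ₀' q
  -- every source `q' ∈ S` sees an off-lobe window at distance `≥ 2E`
  set ρ : ℝ := Real.sqrt (6 / (π ^ 2 * ((E : ℝ) - 1))) + (2 : ℝ)⁻¹ ^ 27 * |(q : ℝ)| with hρ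
  have hρ0 : 0 ≤ ρ := by rw [hρ]; exact add_nonneg (Real.sqrt_nonneg _) (by positivity)
  have hmass : ∀ q' ∈ S, Real.sqrt (∑ l ∈ W, ‖fourierCoeff (twist ψ₁ q) (l - q')‖ ^ 2) ≤ ρ := by
    intro q' hq'
    have hq'Q : |q'| ≤ Qc := by
      rw [hS, Finset.mem_filter, Finset.mem_Icc] at hq'; exact abs_le.2 hq'.1
    have hWd : ∀ l ∈ W, ((2 : ℕ) : ℤ) * E + Qc ≤ |(|l| - |((8 * q : ℤ))|)| := fun l hl => by
      have := hW l hl; push_cast at this ⊢; linarith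
    have h := sum_offLobe_window_sq_norm_twist_le ψ₁ q (N := 2) two_pos (lam := 8 * q) (L := 4 * q) (by ring)
      hg₀t hg₀c hnear hE hq'Q W hWd
    have hη0 : 0 ≤ (2 * Real.exp (1 / 2) - 1) * P.δ₀ / π := by
      have := Real.add_one_le_exp (1 / 2 : ℝ)
      exact div_nonneg (mul_nonneg (by linarith) hδ₀.le) hπ.le
    have hs0 : 0 ≤ Real.sqrt (6 / (π ^ 2 * ((E : ℝ) - 1))) + 2 * π * (|(q : ℝ)| * ((2 * Real.exp (1 / 2) - 1) * P.δ₀ / π)) :=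
      add_nonneg (Real.sqrt_nonneg _) (mul_nonneg (by positivity) (mul_nonneg (abs_nonneg _) hη0))
    have h1 : Real.sqrt (∑ l ∈ W, ‖fourierCoeff (twist ψ₁ q) (l - q')‖ ^ 2) ≤
        Real.sqrt (6 / (π ^ 2 * ((E : ℝ) - 1))) + 2 * π * (|(q : ℝ)| * ((2 * Real.exp (1 / 2) - 1) * P.δ₀ / π)) := by
      rw [← Real.sqrt_le_sqrt_iff (by positivity)] at h
      rwa [Real.sqrt_sq hs0] at h
    rw [hρ]; linarith
  -- bound the Minkowski sum by `L·ρ`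
  have hsum : ∑ q' ∈ S, ‖mFourierCoeff (fun x => (a 1 x : ℂ)) ![q, q']‖ *
      Real.sqrt (∑ l ∈ W, ‖fourierCoeff (twist ψ₁ q) (l - q')‖ ^ 2) ≤ L * ρ := by
    calc ∑ q' ∈ S, ‖mFourierCoeff (fun x => (a 1 x : ℂ)) ![q, q']‖ *
          Real.sqrt (∑ l ∈ W, ‖fourierCoeff (twist ψ₁ q) (l - q')‖ ^ 2)
        ≤ ∑ q' ∈ S, ‖mFourierCoeff (fun x => (a 1 x : ℂ)) ![q, q']‖ * ρ :=
          Finset.sum_le_sum fun q' hq' => mul_le_mul_of_nonneg_left (hmass q' hq') (norm_nonneg _)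
      _ = (∑ q' ∈ S, ‖mFourierCoeff (fun x => (a 1 x : ℂ)) ![q, q']‖) * ρ := by rw [Finset.sum_mul]
      _ ≤ L * ρ := mul_le_mul_of_nonneg_right hL hρ0
  have hX0 : 0 ≤ ∑ l ∈ W, ‖mFourierCoeff (fun x => (b 1 x : ℂ)) ![q, l]‖ ^ 2 := Finset.sum_nonneg fun _ _ => sq_nonneg _
  have hfin := hmink.trans (add_le_add hsum le_rfl)
  have hR0 : 0 ≤ L * ρ + Real.sqrt (∑' q' : ℤ, (if q' ∈ S then 0 else ‖mFourierCoeff (fun x => (a 1 x : ℂ)) ![q, q']‖ ^ 2)) := by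
    have : 0 ≤ L := le_trans (Finset.sum_nonneg fun _ _ => norm_nonneg _) hL
    positivity
  calc ∑ l ∈ W, ‖mFourierCoeff (fun x => (b 1 x : ℂ)) ![q, l]‖ ^ 2
      = Real.sqrt (∑ l ∈ W, ‖mFourierCoeff (fun x => (b 1 x : ℂ)) ![q, l]‖ ^ 2) ^ 2 := (Real.sq_sqrt hX0).symm
    _ ≤ _ := pow_le_pow_left₀ (Real.sqrt_nonneg _) hfin 2

/-! ## §2 From fibres to the lattice -/

/-- **Fibrewise bound of a two-coordinate indicator series**: let `0 ≤ c` be summable on `ℤ²`, `χ : ℤ² → {0,1}`-valued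
(`0 ≤ χ ≤ 1`), `Pc : ℕ`, and suppose every H-fibre `|q| ≤ Pc` obeys `Σ_{l∈W} c(q,l) ≤ B q` for all finite `W` on which `χ(q,·) = 1`…
stated with `χ(q,l) ≠ 0 ⇒ l ∈`-free form: `∀ W, (∀ l ∈ W, χ ![q,l] = 1) → Σ_{l∈W} c ![q,l] ≤ B q`; and the fibres `|q| > Pc` carry total
energy `Σ'_k [Pc < |k₀|] c k ≤ τ`.  Then `Σ'_k χ k · c k ≤ Σ_{|q|≤Pc} B q + τ`. [folklore] -/
theorem tsum_indicator_le_of_fibres (c : (Fin 2 → ℤ) → ℝ) (hc : Summable c) (hc0 : ∀ k, 0 ≤ c k) (χ : (Fin 2 → ℤ) → ℝ)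
    (hχ : ∀ k, χ k = 0 ∨ χ k = 1) (Pc : ℕ) (B : ℤ → ℝ)
    (hB : ∀ q : ℤ, |q| ≤ Pc → ∀ W : Finset ℤ, (∀ l ∈ W, χ ![q, l] = 1) → ∑ l ∈ W, c ![q, l] ≤ B q) {τ : ℝ}
    (hτ : ∑' k : Fin 2 → ℤ, (if (Pc : ℤ) < |k 0| then (1 : ℝ) else 0) * c k ≤ τ) :
    ∑' k : Fin 2 → ℤ, χ k * c k ≤ ∑ q ∈ Finset.Icc (-(Pc : ℤ)) Pc, B q + τ := by
  classical
  have hχ0 : ∀ k, 0 ≤ χ k := fun k => by rcases hχ k with h | h <;> simp [h]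
  have hχ1 : ∀ k, χ k ≤ 1 := fun k => by rcases hχ k with h | h <;> simp [h]
  -- split `χ c` into the fibres `|k₀| ≤ Pc` and the H-tail
  set N : Finset ℤ := Finset.Icc (-(Pc : ℤ)) Pc with hN
  set f₁ : (Fin 2 → ℤ) → ℝ := fun k => if k 0 ∈ N then χ k * c k else 0 with hf₁
  set f₂ : (Fin 2 → ℤ) → ℝ := fun k => (if (Pc : ℤ) < |k 0| then (1 : ℝ) else 0) * c k with hf₂
  have hχc : Summable fun k => χ k * c k :=
    Summable.of_nonneg_of_le (fun k => mul_nonneg (hχ0 k) (hc0 k)) (fun k => mul_le_of_le_one_left (hc0 k) (hχ1 k)) hc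
  have hf₁s : Summable f₁ := Summable.of_nonneg_of_le (fun k => by simp only [hf₁]; split_ifs; exacts [mul_nonneg (hχ0 k) (hc0 k), le_rfl])
    (fun k => by simp only [hf₁]; split_ifs; exacts [le_rfl, mul_nonneg (hχ0 k) (hc0 k)]) hχc
  have hf₂s : Summable f₂ := Summable.of_nonneg_of_le (fun k => by simp only [hf₂]; split_ifs <;> simp [hc0 k])
    (fun k => by simp only [hf₂]; split_ifs <;> simp [hc0 k]) hc
  have hle : ∀ k, χ k * c k ≤ f₁ k + f₂ k := by
    intro k
    simp only [hf₁, hf₂]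
    by_cases h : k 0 ∈ N
    · rw [if_pos h]; have : 0 ≤ (if (Pc : ℤ) < |k 0| then (1 : ℝ) else 0) * c k := by split_ifs <;> simp [hc0 k]
      linarith
    · rw [if_neg h, zero_add]
      have h' : (Pc : ℤ) < |k 0| := by rw [hN, Finset.mem_Icc, ← abs_le, not_le] at h; exact h
      rw [if_pos h', one_mul]
      exact mul_le_of_le_one_left (hc0 k) (hχ1 k)
  have h1 : ∑' k, χ k * c k ≤ ∑' k, f₁ k + ∑' k, f₂ k := by
    rw [← hf₁s.tsum_add hf₂s]
    exact Summable.tsum_le_tsum hle hχc (hf₁s.add hf₂s)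
  -- the fibre part: fibrewise summation and the per-fibre bounds on finite windows
  have h2 : ∑' k, f₁ k ≤ ∑ q ∈ N, B q := by
    -- `f₁ = Σ_{q∈N} [k₀ = q] χ c`
    have hdec : ∀ k, f₁ k = ∑ q ∈ N, (if k 0 = q then χ k * c k else 0) := by
      intro k
      simp only [hf₁]
      by_cases h : k 0 ∈ N
      · rw [if_pos h, Finset.sum_eq_single (k 0) (fun q _ hq => if_neg (Ne.symm hq)) (fun h' => absurd h h')]
        rw [if_pos rfl]
      · rw [if_neg h, Finset.sum_eq_zero fun q hq => if_neg fun h' : k 0 = q => h (h' ▸ hq)]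
    have hsq : ∀ q, Summable fun k : Fin 2 → ℤ => (if k 0 = q then χ k * c k else 0) := fun q =>
      Summable.of_nonneg_of_le (fun k => by split_ifs; exacts [mul_nonneg (hχ0 k) (hc0 k), le_rfl])
        (fun k => by split_ifs; exacts [le_rfl, mul_nonneg (hχ0 k) (hc0 k)]) hχc
    rw [tsum_congr hdec, Summable.tsum_finsetSum fun q _ => hsq q]
    refine Finset.sum_le_sum fun q hq => ?_
    have hqP : |q| ≤ Pc := by rw [hN, Finset.mem_Icc] at hq; exact abs_le.2 hq
    -- the fibre series as a series over `l`, then bounded through finite windows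
    have hinj : Function.Injective (fun l : ℤ => (![q, l] : Fin 2 → ℤ)) := fun a b h => by
      have := congrFun h 1; simpa using this
    have hsupp : Function.support (fun k : Fin 2 → ℤ => if k 0 = q then χ k * c k else 0) ⊆
        Set.range (fun l : ℤ => (![q, l] : Fin 2 → ℤ)) := by
      intro k hk
      rw [Function.mem_support] at hk
      have h1 : k 0 = q := by by_contra h; exact hk (by simp [h])
      exact ⟨k 1, by ext i; fin_cases i <;> simp [h1]⟩
    rw [← hinj.tsum_eq hsupp]
    simp only [Matrix.cons_val_zero, if_true]
    refine Real.tsum_le_of_sum_le (fun l => mul_nonneg (hχ0 _) (hc0 _)) fun u => ?_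
    -- keep only the window points where `χ = 1`
    set W := u.filter (fun l => χ ![q, l] = 1) with hW
    have e : ∑ l ∈ u, χ ![q, l] * c ![q, l] = ∑ l ∈ W, c ![q, l] := by
      rw [hW, Finset.sum_filter]
      refine Finset.sum_congr rfl fun l _ => ?_
      rcases hχ ![q, l] with h | h
      · rw [h, zero_mul, if_neg (by norm_num)]
      · rw [h, one_mul, if_pos rfl]
    rw [e]
    exact hB q hqP W fun l hl => by rw [hW, Finset.mem_filter] at hl; exact hl.2
  have h3 : ∑' k, f₂ k ≤ τ := hτ
  linarith

end Cascade

end Summit.AnomalousDissipation.AnomalousDissipation.Theorems.SawtoothPulseCascade.K1Start
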